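import Summits.KontsevichZagierPeriods.KontsevichZagierPeriods.Theorems.HurwitzMicroSectorsNormalFormPrincipleQuadLog
import Summits.KontsevichZagierPeriods.KontsevichZagierPeriods.Theorems.HurwitzMicroSectorsNormalFormPrincipleAlgNormalForm
import Summits.KontsevichZagierPeriods.KontsevichZagierPeriods.Theorems.HurwitzMicroSectorsNormalFormPrincipleAngCarriers

/-!
# `NormalFormPrinciple` (stmt-KontsevichZagierPeriods-3869), line `SketchIdeator1` —
# the leaf `stub_boxRigidity` in dimension one — the mixed normal form and the pieces of a quadratic pole

Pure proof file (lead seat c3; `--supports` the crux). The **mixed normal form** of a class: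
`[pt, r] + Σⱼ Λ(uⱼ, cⱼ) + Σ_l T(t_l, d_l)` (real algebraic data, `uⱼ > 1`, `t_l ≥ 0`): algebraic
normal forms, zero, sums, pairs of arctangent carriers, points and dlog intervals are mixed normal
forms; so are the arctangent part (`nfD_quad_ang`) and the logarithmic part (`nfD_quad_log`, split at
`u`) of a simple quadratic pole on any slab with algebraic ends.

Sources: M. Kontsevich, D. Zagier, *Periods* (2001), §1.2 rules (1)–(3). No definitions are introduced.
-/

noncomputable section

open MeasureTheory Set Finset
open scoped Polynomial
open Literature.NumberTheory.Transcendental Literature.NumberTheory.Transcendental.KZ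
open Literature.ModelTheory.ExponentialFields (IsSemialgebraic isSemialgebraic_univ)

namespace Summit.KontsevichZagierPeriods.HurwitzMicroSectors.NormalFormPrinciple.PiBox

namespace Dlog

/-! ## The mixed normal form: calculus -/

variable {RA : ℝ → ℝ → ℝ → IntegralRep 1} {ZA : ℝ → IntegralRep 0} {RG : ℝ → ℝ → IntegralRep 1}

/-- `2` is algebraic. [folklore] -/
theorem isAlgebraic_two : IsAlgebraic ℚ (2:ℝ) := by
  rw [show (2:ℝ) = 1 + 1 by norm_num]; exact isAlgebraic_one.add isAlgebraic_one

/-- **An algebraic normal form is a mixed normal form** (no arctangent part).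
[cite: KontsevichZagier2001, §1.2] -/
theorem nfD_of_nfA {x : FormalRep ⧸ relations}
    (hx : ∃ (r : ℝ) (k : ℕ) (u c : Fin k → ℝ), IsAlgebraic ℚ r ∧ (∀ j, 1 < u j) ∧
      (∀ j, IsAlgebraic ℚ (u j)) ∧ (∀ j, IsAlgebraic ℚ (c j)) ∧
      x = QuotientAddGroup.mk' relations (of (ZA r)) +
        ∑ j, QuotientAddGroup.mk' relations (of (RA 1 (u j) (c j)))) :
    ∃ (r : ℝ) (k : ℕ) (u c : Fin k → ℝ) (k' : ℕ) (t d : Fin k' → ℝ), IsAlgebraic ℚ r ∧ (∀ j, 1 < u j) ∧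
      (∀ j, IsAlgebraic ℚ (u j)) ∧ (∀ j, IsAlgebraic ℚ (c j)) ∧ (∀ l, 0 ≤ t l) ∧
      (∀ l, IsAlgebraic ℚ (t l)) ∧ (∀ l, IsAlgebraic ℚ (d l)) ∧
      x = QuotientAddGroup.mk' relations (of (ZA r)) +
        ∑ j, QuotientAddGroup.mk' relations (of (RA 1 (u j) (c j))) +
        ∑ l, QuotientAddGroup.mk' relations (of (RG (t l) (d l))) := by
  obtain ⟨r, k, u, c, hr, hu1, hu, hc, rfl⟩ := hx
  exact ⟨r, k, u, c, 0, Fin.elim0, Fin.elim0, hr, hu1, hu, hc, fun l => l.elim0, fun l => l.elim0,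
    fun l => l.elim0, by rw [Finset.univ_eq_empty (α := Fin 0), Finset.sum_empty, add_zero]⟩

/-- **Zero is in mixed normal form.** [cite: KontsevichZagier2001, §1.2] -/
theorem nfD_zero
    (hZ : ∀ r, IsAlgebraic ℚ r → (ZA r).domain = univ ∧ (ZA r).integrand = fun _ => r) :
    ∃ (r : ℝ) (k : ℕ) (u c : Fin k → ℝ) (k' : ℕ) (t d : Fin k' → ℝ), IsAlgebraic ℚ r ∧ (∀ j, 1 < u j) ∧
      (∀ j, IsAlgebraic ℚ (u j)) ∧ (∀ j, IsAlgebraic ℚ (c j)) ∧ (∀ l, 0 ≤ t l) ∧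
      (∀ l, IsAlgebraic ℚ (t l)) ∧ (∀ l, IsAlgebraic ℚ (d l)) ∧
      (0 : FormalRep ⧸ relations) = QuotientAddGroup.mk' relations (of (ZA r)) +
        ∑ j, QuotientAddGroup.mk' relations (of (RA 1 (u j) (c j))) +
        ∑ l, QuotientAddGroup.mk' relations (of (RG (t l) (d l))) := by
  have hZ0 : QuotientAddGroup.mk' relations (of (ZA 0)) = 0 :=
    (QuotientAddGroup.eq_zero_iff _).mpr (pt_zero_mem_relations (ZA 0) (hZ 0 isAlgebraic_zero).2)
  exact ⟨0, 0, Fin.elim0, Fin.elim0, 0, Fin.elim0, Fin.elim0, isAlgebraic_zero, fun j => j.elim0,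
    fun j => j.elim0, fun j => j.elim0, fun l => l.elim0, fun l => l.elim0, fun l => l.elim0,
    by rw [Finset.univ_eq_empty (α := Fin 0), Finset.sum_empty, Finset.sum_empty, add_zero, add_zero, hZ0]⟩

/-- **Additivity of mixed normal forms.** [cite: KontsevichZagier2001, §1.2 rule (1)] -/
theorem nfD_add
    (hZ : ∀ r, IsAlgebraic ℚ r → (ZA r).domain = univ ∧ (ZA r).integrand = fun _ => r)
    {x y : FormalRep ⧸ relations}
    (hx : ∃ (r : ℝ) (k : ℕ) (u c : Fin k → ℝ) (k' : ℕ) (t d : Fin k' → ℝ), IsAlgebraic ℚ r ∧ (∀ j, 1 < u j) ∧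
      (∀ j, IsAlgebraic ℚ (u j)) ∧ (∀ j, IsAlgebraic ℚ (c j)) ∧ (∀ l, 0 ≤ t l) ∧
      (∀ l, IsAlgebraic ℚ (t l)) ∧ (∀ l, IsAlgebraic ℚ (d l)) ∧
      x = QuotientAddGroup.mk' relations (of (ZA r)) +
        ∑ j, QuotientAddGroup.mk' relations (of (RA 1 (u j) (c j))) +
        ∑ l, QuotientAddGroup.mk' relations (of (RG (t l) (d l))))
    (hy : ∃ (r : ℝ) (k : ℕ) (u c : Fin k → ℝ) (k' : ℕ) (t d : Fin k' → ℝ), IsAlgebraic ℚ r ∧ (∀ j, 1 < u j) ∧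
      (∀ j, IsAlgebraic ℚ (u j)) ∧ (∀ j, IsAlgebraic ℚ (c j)) ∧ (∀ l, 0 ≤ t l) ∧
      (∀ l, IsAlgebraic ℚ (t l)) ∧ (∀ l, IsAlgebraic ℚ (d l)) ∧
      y = QuotientAddGroup.mk' relations (of (ZA r)) +
        ∑ j, QuotientAddGroup.mk' relations (of (RA 1 (u j) (c j))) +
        ∑ l, QuotientAddGroup.mk' relations (of (RG (t l) (d l)))) :
    ∃ (r : ℝ) (k : ℕ) (u c : Fin k → ℝ) (k' : ℕ) (t d : Fin k' → ℝ), IsAlgebraic ℚ r ∧ (∀ j, 1 < u j) ∧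
      (∀ j, IsAlgebraic ℚ (u j)) ∧ (∀ j, IsAlgebraic ℚ (c j)) ∧ (∀ l, 0 ≤ t l) ∧
      (∀ l, IsAlgebraic ℚ (t l)) ∧ (∀ l, IsAlgebraic ℚ (d l)) ∧
      x + y = QuotientAddGroup.mk' relations (of (ZA r)) +
        ∑ j, QuotientAddGroup.mk' relations (of (RA 1 (u j) (c j))) +
        ∑ l, QuotientAddGroup.mk' relations (of (RG (t l) (d l))) := by
  obtain ⟨r, k, u, c, k', t, d, hr, hu1, hu, hc, ht0, ht, hd, rfl⟩ := hx
  obtain ⟨r', m, u', c', m', t', d', hr', hu1', hu', hc', ht0', ht', hd', rfl⟩ := hy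
  refine ⟨r + r', k + m, Fin.append u u', Fin.append c c', k' + m', Fin.append t t', Fin.append d d',
    hr.add hr', fun j => ?_, fun j => ?_, fun j => ?_, fun l => ?_, fun l => ?_, fun l => ?_, ?_⟩
  · refine Fin.addCases (fun i => ?_) (fun i => ?_) j
    · simpa using hu1 i
    · simpa using hu1' i
  · refine Fin.addCases (fun i => ?_) (fun i => ?_) j
    · simpa using hu i
    · simpa using hu' i
  · refine Fin.addCases (fun i => ?_) (fun i => ?_) j
    · simpa using hc i
    · simpa using hc' i
  · refine Fin.addCases (fun i => ?_) (fun i => ?_) l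
    · simpa using ht0 i
    · simpa using ht0' i
  · refine Fin.addCases (fun i => ?_) (fun i => ?_) l
    · simpa using ht i
    · simpa using ht' i
  · refine Fin.addCases (fun i => ?_) (fun i => ?_) l
    · simpa using hd i
    · simpa using hd' i
  have hpt : QuotientAddGroup.mk' relations (of (ZA (r + r'))) =
      QuotientAddGroup.mk' relations (of (ZA r)) + QuotientAddGroup.mk' relations (of (ZA r')) := by
    have h := pt_add_mem_relations (r := r) (r' := r') (ZA (r + r')) (ZA r) (ZA r')
      (hZ _ (hr.add hr')).1 (hZ _ hr).1 (hZ _ hr').1 (hZ _ (hr.add hr')).2 (hZ _ hr).2 (hZ _ hr').2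
    rw [← QuotientAddGroup.eq_zero_iff] at h
    change QuotientAddGroup.mk' relations _ = 0 at h
    rwa [map_sub, map_sub, sub_sub, sub_eq_zero] at h
  rw [hpt, Fin.sum_univ_add, Fin.sum_univ_add]
  simp only [Fin.append_left, Fin.append_right]
  abel

/-- **A pair of arctangent carriers is in mixed normal form.** [cite: KontsevichZagier2001, §1.2] -/
theorem nfD_angPair
    (hZ : ∀ r, IsAlgebraic ℚ r → (ZA r).domain = univ ∧ (ZA r).integrand = fun _ => r)
    {x : FormalRep ⧸ relations} {t₁ t₂ d₁ d₂ : ℝ} (ht₁ : 0 ≤ t₁) (ht₂ : 0 ≤ t₂)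
    (ht₁A : IsAlgebraic ℚ t₁) (ht₂A : IsAlgebraic ℚ t₂) (hd₁ : IsAlgebraic ℚ d₁) (hd₂ : IsAlgebraic ℚ d₂)
    (hx : x = QuotientAddGroup.mk' relations (of (RG t₁ d₁)) + QuotientAddGroup.mk' relations (of (RG t₂ d₂))) :
    ∃ (r : ℝ) (k : ℕ) (u c : Fin k → ℝ) (k' : ℕ) (t d : Fin k' → ℝ), IsAlgebraic ℚ r ∧ (∀ j, 1 < u j) ∧
      (∀ j, IsAlgebraic ℚ (u j)) ∧ (∀ j, IsAlgebraic ℚ (c j)) ∧ (∀ l, 0 ≤ t l) ∧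
      (∀ l, IsAlgebraic ℚ (t l)) ∧ (∀ l, IsAlgebraic ℚ (d l)) ∧
      x = QuotientAddGroup.mk' relations (of (ZA r)) +
        ∑ j, QuotientAddGroup.mk' relations (of (RA 1 (u j) (c j))) +
        ∑ l, QuotientAddGroup.mk' relations (of (RG (t l) (d l))) := by
  have hZ0 : QuotientAddGroup.mk' relations (of (ZA 0)) = 0 :=
    (QuotientAddGroup.eq_zero_iff _).mpr (pt_zero_mem_relations (ZA 0) (hZ 0 isAlgebraic_zero).2)
  refine ⟨0, 0, Fin.elim0, Fin.elim0, 2, ![t₁, t₂], ![d₁, d₂], isAlgebraic_zero, fun j => j.elim0,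
    fun j => j.elim0, fun j => j.elim0, ?_, ?_, ?_, ?_⟩
  · exact Fin.forall_fin_two.mpr ⟨by simpa using ht₁, by simpa using ht₂⟩
  · exact Fin.forall_fin_two.mpr ⟨by simpa using ht₁A, by simpa using ht₂A⟩
  · exact Fin.forall_fin_two.mpr ⟨by simpa using hd₁, by simpa using hd₂⟩
  · rw [Finset.univ_eq_empty (α := Fin 0), Finset.sum_empty, add_zero, hZ0, zero_add, Fin.sum_univ_two]
    simpa using hx

/-- **A point is in mixed normal form.** [cite: KontsevichZagier2001, §1.2 rule (1)] -/
theorem nfD_pt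
    (hZ : ∀ r, IsAlgebraic ℚ r → (ZA r).domain = univ ∧ (ZA r).integrand = fun _ => r)
    {r : ℝ} (hr : IsAlgebraic ℚ r) (Zpt : IntegralRep 0) (hd : Zpt.domain = univ)
    (hi : Zpt.integrand = fun _ => r) :
    ∃ (r : ℝ) (k : ℕ) (u c : Fin k → ℝ) (k' : ℕ) (t d : Fin k' → ℝ), IsAlgebraic ℚ r ∧ (∀ j, 1 < u j) ∧
      (∀ j, IsAlgebraic ℚ (u j)) ∧ (∀ j, IsAlgebraic ℚ (c j)) ∧ (∀ l, 0 ≤ t l) ∧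
      (∀ l, IsAlgebraic ℚ (t l)) ∧ (∀ l, IsAlgebraic ℚ (d l)) ∧
      QuotientAddGroup.mk' relations (of Zpt) = QuotientAddGroup.mk' relations (of (ZA r)) +
        ∑ j, QuotientAddGroup.mk' relations (of (RA 1 (u j) (c j))) +
        ∑ l, QuotientAddGroup.mk' relations (of (RG (t l) (d l))) :=
  nfD_of_nfA (nfA_pt (RA := RA) hZ hr Zpt hd hi)

/-- **A dlog interval with algebraic data is in mixed normal form** (empty if `b ≤ a`).
[cite: KontsevichZagier2001, §1.2 rule (2)] -/
theorem nfD_dlog_any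
    (hR : ∀ a b c, IsAlgebraic ℚ a → IsAlgebraic ℚ b → IsAlgebraic ℚ c → 0 < a →
      (RA a b c).domain = {x | x 0 ∈ Set.Ioo a b} ∧ (RA a b c).integrand = fun x => c / x 0)
    (hZ : ∀ r, IsAlgebraic ℚ r → (ZA r).domain = univ ∧ (ZA r).integrand = fun _ => r)
    {a b c : ℝ} (ha : IsAlgebraic ℚ a) (hb : IsAlgebraic ℚ b) (hc : IsAlgebraic ℚ c) (ha0 : 0 < a)
    (L : IntegralRep 1) (hd : L.domain = {x | x 0 ∈ Set.Ioo a b})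
    (hi : EqOn L.integrand (fun x => c / x 0) L.domain) :
    ∃ (r : ℝ) (k : ℕ) (u c : Fin k → ℝ) (k' : ℕ) (t d : Fin k' → ℝ), IsAlgebraic ℚ r ∧ (∀ j, 1 < u j) ∧
      (∀ j, IsAlgebraic ℚ (u j)) ∧ (∀ j, IsAlgebraic ℚ (c j)) ∧ (∀ l, 0 ≤ t l) ∧
      (∀ l, IsAlgebraic ℚ (t l)) ∧ (∀ l, IsAlgebraic ℚ (d l)) ∧
      QuotientAddGroup.mk' relations (of L) = QuotientAddGroup.mk' relations (of (ZA r)) +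
        ∑ j, QuotientAddGroup.mk' relations (of (RA 1 (u j) (c j))) +
        ∑ l, QuotientAddGroup.mk' relations (of (RG (t l) (d l))) := by
  by_cases hab : a < b
  · exact nfD_of_nfA (nfA_dlog hR hZ ha hb hc ha0 hab L hd hi)
  · have h0 : QuotientAddGroup.mk' relations (of L) = 0 :=
      (QuotientAddGroup.eq_zero_iff _).mpr (slab_empty_mem_relations L hd (not_lt.mp hab))
    rw [h0]
    exact nfD_zero hZ

/-! ## The pieces of a quadratic pole are in mixed normal form -/

/-- **The arctangent part** `[(a,b), c/((x−u)²+v²)]` is in mixed normal form (affine substitution to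
`[·, (c/v)/(1+y²)]`, then `ang_interval_eq`). [cite: KontsevichZagier2001, §1.2 rules (1), (2)] -/
theorem nfD_quad_ang
    {RA : ℝ → ℝ → ℝ → IntegralRep 1} {ZA : ℝ → IntegralRep 0} {RG : ℝ → ℝ → IntegralRep 1}
    (hZ : ∀ r, IsAlgebraic ℚ r → (ZA r).domain = univ ∧ (ZA r).integrand = fun _ => r)
    (hRG : ∀ t d, IsAlgebraic ℚ t → IsAlgebraic ℚ d →
      (RG t d).domain = {x | x 0 ∈ Set.Ioo 0 t} ∧ (RG t d).integrand = fun x => d / (1 + x 0 ^ 2))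
    {a b c u v : ℝ} (ha : IsAlgebraic ℚ a) (hb : IsAlgebraic ℚ b) (hc : IsAlgebraic ℚ c)
    (hu : IsAlgebraic ℚ u) (hv : IsAlgebraic ℚ v) (hv0 : 0 < v) (hab : a ≤ b)
    (N : IntegralRep 1) (hNd : N.domain = {x | x 0 ∈ Set.Ioo a b})
    (hNi : EqOn N.integrand (fun x => c / ((x 0 - u) ^ 2 + v ^ 2)) N.domain) :
    ∃ (r : ℝ) (k : ℕ) (u c : Fin k → ℝ) (k' : ℕ) (t d : Fin k' → ℝ), IsAlgebraic ℚ r ∧ (∀ j, 1 < u j) ∧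
      (∀ j, IsAlgebraic ℚ (u j)) ∧ (∀ j, IsAlgebraic ℚ (c j)) ∧ (∀ l, 0 ≤ t l) ∧
      (∀ l, IsAlgebraic ℚ (t l)) ∧ (∀ l, IsAlgebraic ℚ (d l)) ∧
      QuotientAddGroup.mk' relations (of N) = QuotientAddGroup.mk' relations (of (ZA r)) +
        ∑ j, QuotientAddGroup.mk' relations (of (RA 1 (u j) (c j))) +
        ∑ l, QuotientAddGroup.mk' relations (of (RG (t l) (d l))) := by
  have haA : IsAlgebraic ℚ ((a - u) / v) := by rw [div_eq_mul_inv]; exact (ha.sub hu).mul hv.inv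
  have hbA : IsAlgebraic ℚ ((b - u) / v) := by rw [div_eq_mul_inv]; exact (hb.sub hu).mul hv.inv
  have hcA : IsAlgebraic ℚ (c / v) := by rw [div_eq_mul_inv]; exact hc.mul hv.inv
  obtain ⟨L, hLd, hLi⟩ := exists_angA haA hbA hcA
  have hLi' : EqOn L.integrand (fun x => (c / v) / (1 + x 0 ^ 2)) L.domain := by
    rw [hLi]; exact fun _ _ => rfl
  have h := quad_ang_sub_mem_relations hu hv hv0 N L hNd hNi hLd hLi'
  rw [← QuotientAddGroup.eq_zero_iff] at h
  change QuotientAddGroup.mk' relations _ = 0 at h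
  rw [map_sub, sub_eq_zero] at h
  obtain ⟨t₁, t₂, d₁, d₂, ht₁, ht₂, ht₁A, ht₂A, hd₁, hd₂, hEq⟩ :=
    ang_interval_eq hRG haA hbA hcA (div_le_div_of_nonneg_right (by linarith) hv0.le) L hLd hLi'
  exact nfD_angPair hZ ht₁ ht₂ ht₁A ht₂A hd₁ hd₂ (by rw [h, hEq])

/-- **The logarithmic part to the right of `u`** is in mixed normal form.
[cite: KontsevichZagier2001, §1.2 rule (2)] -/
theorem nfD_quad_log_right
    (hR : ∀ a b c, IsAlgebraic ℚ a → IsAlgebraic ℚ b → IsAlgebraic ℚ c → 0 < a →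
      (RA a b c).domain = {x | x 0 ∈ Set.Ioo a b} ∧ (RA a b c).integrand = fun x => c / x 0)
    (hZ : ∀ r, IsAlgebraic ℚ r → (ZA r).domain = univ ∧ (ZA r).integrand = fun _ => r)
    {a b A u v : ℝ} (ha : IsAlgebraic ℚ a) (hb : IsAlgebraic ℚ b) (hA : IsAlgebraic ℚ A)
    (hu : IsAlgebraic ℚ u) (hv : IsAlgebraic ℚ v) (hv0 : 0 < v) (hua : u ≤ a) (hab : a ≤ b)
    (N : IntegralRep 1) (hNd : N.domain = {x | x 0 ∈ Set.Ioo a b})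
    (hNi : EqOn N.integrand (fun x => A * (x 0 - u) / ((x 0 - u) ^ 2 + v ^ 2)) N.domain) :
    ∃ (r : ℝ) (k : ℕ) (u c : Fin k → ℝ) (k' : ℕ) (t d : Fin k' → ℝ), IsAlgebraic ℚ r ∧ (∀ j, 1 < u j) ∧
      (∀ j, IsAlgebraic ℚ (u j)) ∧ (∀ j, IsAlgebraic ℚ (c j)) ∧ (∀ l, 0 ≤ t l) ∧
      (∀ l, IsAlgebraic ℚ (t l)) ∧ (∀ l, IsAlgebraic ℚ (d l)) ∧
      QuotientAddGroup.mk' relations (of N) = QuotientAddGroup.mk' relations (of (ZA r)) +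
        ∑ j, QuotientAddGroup.mk' relations (of (RA 1 (u j) (c j))) +
        ∑ l, QuotientAddGroup.mk' relations (of (RG (t l) (d l))) := by
  have h1A : IsAlgebraic ℚ ((a - u) ^ 2 + v ^ 2) := ((ha.sub hu).pow 2).add (hv.pow 2)
  have h2A : IsAlgebraic ℚ ((b - u) ^ 2 + v ^ 2) := ((hb.sub hu).pow 2).add (hv.pow 2)
  have hcA : IsAlgebraic ℚ (A / 2) := by rw [div_eq_mul_inv]; exact hA.mul isAlgebraic_two.inv
  obtain ⟨L, hLd, hLi⟩ := exists_dlogA h1A h2A hcA (quad_pos hv0.ne' a)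
  have hLi' : EqOn L.integrand (fun x => (A / 2) / x 0) L.domain := by rw [hLi]; exact fun _ _ => rfl
  have h := quad_log_right_sub_mem_relations ha hb hu hv hv0 hua hab N L hNd hNi hLd hLi'
  rw [← QuotientAddGroup.eq_zero_iff] at h
  change QuotientAddGroup.mk' relations _ = 0 at h
  rw [map_sub, sub_eq_zero] at h
  rw [h]
  exact nfD_dlog_any hR hZ h1A h2A hcA (quad_pos hv0.ne' a) L hLd hLi'

/-- **The logarithmic part to the left of `u`** is in mixed normal form.
[cite: KontsevichZagier2001, §1.2 rule (2)] -/
theorem nfD_quad_log_left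
    (hR : ∀ a b c, IsAlgebraic ℚ a → IsAlgebraic ℚ b → IsAlgebraic ℚ c → 0 < a →
      (RA a b c).domain = {x | x 0 ∈ Set.Ioo a b} ∧ (RA a b c).integrand = fun x => c / x 0)
    (hZ : ∀ r, IsAlgebraic ℚ r → (ZA r).domain = univ ∧ (ZA r).integrand = fun _ => r)
    {a b A u v : ℝ} (ha : IsAlgebraic ℚ a) (hb : IsAlgebraic ℚ b) (hA : IsAlgebraic ℚ A)
    (hu : IsAlgebraic ℚ u) (hv : IsAlgebraic ℚ v) (hv0 : 0 < v) (hbu : b ≤ u) (hab : a ≤ b)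
    (N : IntegralRep 1) (hNd : N.domain = {x | x 0 ∈ Set.Ioo a b})
    (hNi : EqOn N.integrand (fun x => A * (x 0 - u) / ((x 0 - u) ^ 2 + v ^ 2)) N.domain) :
    ∃ (r : ℝ) (k : ℕ) (u c : Fin k → ℝ) (k' : ℕ) (t d : Fin k' → ℝ), IsAlgebraic ℚ r ∧ (∀ j, 1 < u j) ∧
      (∀ j, IsAlgebraic ℚ (u j)) ∧ (∀ j, IsAlgebraic ℚ (c j)) ∧ (∀ l, 0 ≤ t l) ∧
      (∀ l, IsAlgebraic ℚ (t l)) ∧ (∀ l, IsAlgebraic ℚ (d l)) ∧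
      QuotientAddGroup.mk' relations (of N) = QuotientAddGroup.mk' relations (of (ZA r)) +
        ∑ j, QuotientAddGroup.mk' relations (of (RA 1 (u j) (c j))) +
        ∑ l, QuotientAddGroup.mk' relations (of (RG (t l) (d l))) := by
  have h1A : IsAlgebraic ℚ ((b - u) ^ 2 + v ^ 2) := ((hb.sub hu).pow 2).add (hv.pow 2)
  have h2A : IsAlgebraic ℚ ((a - u) ^ 2 + v ^ 2) := ((ha.sub hu).pow 2).add (hv.pow 2)
  have hcA : IsAlgebraic ℚ (-A / 2) := by rw [div_eq_mul_inv]; exact hA.neg.mul isAlgebraic_two.inv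
  obtain ⟨L, hLd, hLi⟩ := exists_dlogA h1A h2A hcA (quad_pos hv0.ne' b)
  have hLi' : EqOn L.integrand (fun x => (-A / 2) / x 0) L.domain := by rw [hLi]; exact fun _ _ => rfl
  have h := quad_log_left_sub_mem_relations ha hb hA hu hv hv0 hbu hab N L hNd hNi hLd hLi'
  rw [← QuotientAddGroup.eq_zero_iff] at h
  change QuotientAddGroup.mk' relations _ = 0 at h
  rw [map_sub, sub_eq_zero] at h
  rw [h]
  exact nfD_dlog_any hR hZ h1A h2A hcA (quad_pos hv0.ne' b) L hLd hLi'

/-- **The logarithmic part** `[(a,b), A(x−u)/((x−u)²+v²)]` is in mixed normal form (split at `u` if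
needed). [cite: KontsevichZagier2001, §1.2 rules (1), (2)] -/
theorem nfD_quad_log
    {RA : ℝ → ℝ → ℝ → IntegralRep 1} {ZA : ℝ → IntegralRep 0} {RG : ℝ → ℝ → IntegralRep 1}
    (hR : ∀ a b c, IsAlgebraic ℚ a → IsAlgebraic ℚ b → IsAlgebraic ℚ c → 0 < a →
      (RA a b c).domain = {x | x 0 ∈ Set.Ioo a b} ∧ (RA a b c).integrand = fun x => c / x 0)
    (hZ : ∀ r, IsAlgebraic ℚ r → (ZA r).domain = univ ∧ (ZA r).integrand = fun _ => r)
    {a b A u v : ℝ} (ha : IsAlgebraic ℚ a) (hb : IsAlgebraic ℚ b) (hA : IsAlgebraic ℚ A)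
    (hu : IsAlgebraic ℚ u) (hv : IsAlgebraic ℚ v) (hv0 : 0 < v) (hab : a ≤ b)
    (N : IntegralRep 1) (hNd : N.domain = {x | x 0 ∈ Set.Ioo a b})
    (hNi : EqOn N.integrand (fun x => A * (x 0 - u) / ((x 0 - u) ^ 2 + v ^ 2)) N.domain) :
    ∃ (r : ℝ) (k : ℕ) (u c : Fin k → ℝ) (k' : ℕ) (t d : Fin k' → ℝ), IsAlgebraic ℚ r ∧ (∀ j, 1 < u j) ∧
      (∀ j, IsAlgebraic ℚ (u j)) ∧ (∀ j, IsAlgebraic ℚ (c j)) ∧ (∀ l, 0 ≤ t l) ∧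
      (∀ l, IsAlgebraic ℚ (t l)) ∧ (∀ l, IsAlgebraic ℚ (d l)) ∧
      QuotientAddGroup.mk' relations (of N) = QuotientAddGroup.mk' relations (of (ZA r)) +
        ∑ j, QuotientAddGroup.mk' relations (of (RA 1 (u j) (c j))) +
        ∑ l, QuotientAddGroup.mk' relations (of (RG (t l) (d l))) := by
  rcases le_or_gt u a with hua | hua
  · exact nfD_quad_log_right hR hZ ha hb hA hu hv hv0 hua hab N hNd hNi
  rcases le_or_gt b u with hbu | hbu
  · exact nfD_quad_log_left hR hZ ha hb hA hu hv hv0 hbu hab N hNd hNi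
  -- `a < u < b`: split at `u`
  obtain ⟨N₁, hN₁d, hN₁i⟩ := exists_quadRep (a := a) (b := u) (B := 0) ha hu hA isAlgebraic_zero hu hv
    hv0.ne' 1
  obtain ⟨N₂, hN₂d, hN₂i⟩ := exists_quadRep (a := u) (b := b) (B := 0) hu hb hA isAlgebraic_zero hu hv
    hv0.ne' 1
  have hN₁i' : EqOn N₁.integrand (fun x => A * (x 0 - u) / ((x 0 - u) ^ 2 + v ^ 2)) N₁.domain := by
    intro x _; rw [hN₁i]; simp only [add_zero, pow_one]
  have hN₂i' : EqOn N₂.integrand (fun x => A * (x 0 - u) / ((x 0 - u) ^ 2 + v ^ 2)) N₂.domain := by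
    intro x _; rw [hN₂i]; simp only [add_zero, pow_one]
  have hsplit : of N - of N₁ - of N₂ ∈ relations := by
    refine split_mem_relations N N₁ N₂ hNd hN₁d hN₂d hua.le hbu.le (fun x hx => ?_) (fun x hx => ?_)
    · rw [hN₁i' hx, hNi (by rw [hNd]; rw [hN₁d] at hx; exact ⟨hx.1, lt_trans hx.2 hbu⟩)]
    · rw [hN₂i' hx, hNi (by rw [hNd]; rw [hN₂d] at hx; exact ⟨lt_trans hua hx.1, hx.2⟩)]
  rw [← QuotientAddGroup.eq_zero_iff] at hsplit
  change QuotientAddGroup.mk' relations _ = 0 at hsplit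
  rw [map_sub, map_sub, sub_sub, sub_eq_zero] at hsplit
  rw [hsplit]
  exact nfD_add hZ (nfD_quad_log_left hR hZ ha hu hA hu hv hv0 le_rfl hua.le N₁ hN₁d hN₁i')
    (nfD_quad_log_right hR hZ hu hb hA hu hv hv0 le_rfl hbu.le N₂ hN₂d hN₂i')

end Dlog

end Summit.KontsevichZagierPeriods.HurwitzMicroSectors.NormalFormPrinciple.PiBox
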